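import Mathlib
import HarnessLib
import Literature.Analysis.FluidPDE.SuitableWeak
import Literature.Analysis.FluidPDE.SelfSimilar
import Literature.Analysis.FluidPDE.LocalTypeI
import Literature.Analysis.FluidPDE.SpaceTimeRescaling
import Literature.Analysis.FluidPDE.LocalTypeIScaling
import Summits.NavierStokesRegularity.NavierStokesRegularity.Theorems.RellichScarApexLocalisationParentChild

/-!
# Covariance of the dissipation quantum (line dissipation-quantum-tolerance, crux ApexLocalisation,
# stub `stub_quantumCovariance`)

`stub_quantumCovariance`: in the continuous rate-Type-I class with data `(C, I)` (suitable weak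
solutions `(u, p)` of Navier–Stokes on the backward slab `(-∞, 0) × ℝ³` with weak spatial gradient
`G`, Albritton–Barker quantity `𝐈 ≤ I`, rate `‖u(t, x)‖ ≤ C / √(-t)`, continuous on the open
slab), suppose every class profile singular at the space–time ORIGIN dissipates at least `e` on the
unit band `Q((-1/4, 0), 1/2) = (-1/2, -1/4) × B_{1/2}(0)`. Then every class profile singular at a
final-slice point `(0, b)` dissipates at least `e ρ` on the band `Q((-ρ²/4, b), ρ/2) =
(-ρ²/2, -ρ²/4) × B_{ρ/2}(b)` of every scale `ρ > 0`.

Proof (bookkeeping with the Navier–Stokes symmetries, the parabolic scaling of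
Escauriaza–Seregin–Šverák 2003, §3, as used by Albritton–Barker 2019, §3): the image
`w(t, x) = ρ u(ρ² t, b + ρ x)` (pressure `ρ² p ∘ Φ`, gradient `ρ² G ∘ Φ`,
`Φ = stAffine (ρ²) ρ 0 b`) keeps the class data (tree `image_classData`) and is singular at the
origin (tree `eLpNorm_top_nsZoom`: `‖w‖_{L^∞(Q(0, r))} = ρ ‖u‖_{L^∞(Q((0, b), ρ r))} = ∞`,
`isBackwardSingularPoint_image_of_centre`), so the hypothesis gives
`e ≤ ∫∫_{Q((-1/4, 0), 1/2)} |G_w|²`; by the scale covariance of the scaled dissipation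
(tree `cknE_nsZoom`, with `Φ(-1/4, 0) = (-ρ²/4, b)`) the right-hand side equals
`ρ⁻¹ ∫∫_{Q((-ρ²/4, b), ρ/2)} |G|²` (`lintegral_unitBand_image_eq`).

## References

* L. Escauriaza, G. Seregin, V. Šverák, *`L_{3,∞}`-solutions of Navier–Stokes equations and
  backward uniqueness*, Russian Math. Surveys 58 (2003), §3 (parabolic scaling).
* D. Albritton, T. Barker, *On local Type I singularities of the Navier–Stokes equations and
  Liouville theorems*, J. Math. Fluid Mech. 21 (2019), §1 and §3.
-/

-- the summit and its single sub-problem share the name (CONVENTIONS §1), as in every Theorems file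
set_option linter.dupNamespace false

namespace Summit.NavierStokesRegularity.NavierStokesRegularity.Theorems.RellichScarApexLocalisation

open MeasureTheory Set Function Metric Filter Topology TopologicalSpace
open scoped ENNReal NNReal
open Literature.Analysis Literature.Analysis.FluidPDE

local notation "E³" => EuclideanSpace ℝ (Fin 3)

/-! ### The image centred at a singular final-slice point is singular at the origin -/

/-- **The image centred at a singular final-slice point is singular at the origin**: if `u` is
singular at `(0, b)`, then the Navier–Stokes image `ρ u(ρ² t, b + ρ x)` (`ρ > 0`) is singular at
the space–time origin (`‖w‖_{L^∞(Q(0, r))} = ρ ‖u‖_{L^∞(Q((0, b), ρ r))}`, `eLpNorm_top_nsZoom`). -/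
theorem isBackwardSingularPoint_image_of_centre {u : ℝ → E³ → E³} {b : E³}
    (hsing : IsBackwardSingularPoint u ((0 : ℝ), b)) {ρ : ℝ} (hρ : 0 < ρ) :
    IsBackwardSingularPoint (ρ • stPull (ρ ^ 2) ρ 0 b u) 0 := by
  intro r hr
  rw [eLpNorm_top_nsZoom hρ 0 b r 0 u]
  have h0 : stAffine (ρ ^ 2) ρ 0 b (0 : ℝ × E³) = ((0 : ℝ), b) := by
    rw [show (0 : ℝ × E³) = ((0 : ℝ), (0 : E³)) from rfl, stAffine_apply, mul_zero, add_zero,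
      smul_zero, add_zero]
  rw [h0, hsing (ρ * r) (mul_pos hρ hr)]
  exact ENNReal.mul_top (ENNReal.ofReal_pos.2 hρ).ne'

/-! ### Scale covariance of the band dissipation -/

/-- **Scale covariance of the band dissipation**: for `ρ > 0`,
`∫∫_{Q((-1/4, 0), 1/2)} |ρ² G(ρ² t, b + ρ x)|² dx dt = ρ⁻¹ ∫∫_{Q((-ρ²/4, b), ρ/2)} |G|² dx dt`
(`cknE_nsZoom` with `Φ(-1/4, 0) = (-ρ²/4, b)` and `ρ · (1/2) = ρ/2`, unfolded:
`E(G_w; Q(z, r)) = E(G; Q(Φ z, ρ r))`, `E(G; Q(z, r)) = r⁻¹ ∫∫_{Q(z, r)} |G|²`). -/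
theorem lintegral_unitBand_image_eq {G : ℝ → E³ → E³ →L[ℝ] E³} (b : E³) {ρ : ℝ} (hρ : 0 < ρ) :
    ∫⁻ z in parabolicCylinder (1 / 2 : ℝ) ((-(1 / 4) : ℝ), (0 : E³)),
        ENNReal.ofReal (frobeniusNormSq ((ρ ^ 2 • stPull (ρ ^ 2) ρ 0 b G) z.1 z.2)) =
      (ENNReal.ofReal ρ)⁻¹ * ∫⁻ z in parabolicCylinder (ρ / 2) ((-(ρ ^ 2 / 4) : ℝ), b),
        ENNReal.ofReal (frobeniusNormSq (G z.1 z.2)) := by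
  have h := cknE_nsZoom hρ (by norm_num : (0 : ℝ) < 1 / 2) 0 b ((-(1 / 4) : ℝ), (0 : E³)) G
  have hz : stAffine (ρ ^ 2) ρ 0 b ((-(1 / 4) : ℝ), (0 : E³)) = ((-(ρ ^ 2 / 4) : ℝ), b) := by
    rw [stAffine_apply, smul_zero, add_zero]
    congr 1
    ring
  rw [hz, show ρ * (1 / 2) = ρ / 2 by ring] at h
  unfold cknE at h
  have h2 : ENNReal.ofReal (1 / 2 : ℝ) ≠ 0 := (ENNReal.ofReal_pos.2 (by norm_num)).ne'
  calc ∫⁻ z in parabolicCylinder (1 / 2 : ℝ) ((-(1 / 4) : ℝ), (0 : E³)),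
        ENNReal.ofReal (frobeniusNormSq ((ρ ^ 2 • stPull (ρ ^ 2) ρ 0 b G) z.1 z.2))
      = ENNReal.ofReal (1 / 2 : ℝ) * ((ENNReal.ofReal (1 / 2 : ℝ))⁻¹ *
          ∫⁻ z in parabolicCylinder (1 / 2 : ℝ) ((-(1 / 4) : ℝ), (0 : E³)),
            ENNReal.ofReal (frobeniusNormSq ((ρ ^ 2 • stPull (ρ ^ 2) ρ 0 b G) z.1 z.2))) := by
        rw [← mul_assoc, ENNReal.mul_inv_cancel h2 ENNReal.ofReal_ne_top, one_mul]
    _ = ENNReal.ofReal (1 / 2 : ℝ) * ((ENNReal.ofReal (ρ / 2))⁻¹ *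
          ∫⁻ z in parabolicCylinder (ρ / 2) ((-(ρ ^ 2 / 4) : ℝ), b),
            ENNReal.ofReal (frobeniusNormSq (G z.1 z.2))) := by rw [h]
    _ = (ENNReal.ofReal ρ)⁻¹ * ∫⁻ z in parabolicCylinder (ρ / 2) ((-(ρ ^ 2 / 4) : ℝ), b),
            ENNReal.ofReal (frobeniusNormSq (G z.1 z.2)) := by
        rw [← mul_assoc, ← ENNReal.ofReal_inv_of_pos (by positivity : (0 : ℝ) < ρ / 2),
          ← ENNReal.ofReal_mul (by norm_num : (0 : ℝ) ≤ 1 / 2), ← ENNReal.ofReal_inv_of_pos hρ]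
        congr 2
        rw [inv_div]
        ring

/-! ### S5 — covariance of the dissipation quantum -/

/-- **S5, COVARIANCE OF THE DISSIPATION QUANTUM.** If every continuous class-`(C, I)` profile
singular at the origin dissipates at least `e` on the unit band `Q((-1/4, 0), 1/2)`, then every
continuous class-`(C, I)` profile singular at a final-slice point `(0, b)` dissipates at least
`e ρ` on the band `Q((-ρ²/4, b), ρ/2)`, for every `ρ > 0`: apply the hypothesis to the image
`ρ u(ρ² t, b + ρ x)` (class data by `image_classData`, singular origin by
`isBackwardSingularPoint_image_of_centre`) and change variables
(`lintegral_unitBand_image_eq`). -/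
theorem stub_quantumCovariance :
    ∀ (C : ℝ) (I : ℝ≥0∞) (e : ℝ), 0 ≤ e →
      (∀ (u : ℝ → E³ → E³) (p : ℝ → E³ → ℝ) (G : ℝ → E³ → E³ →L[ℝ] E³),
        IsSuitableWeakSolutionOn (slab E³ (Iio 0) isOpen_Iio) 1 0 u p →
        HasWeakSpatialGradientOn (slab E³ (Iio 0) isOpen_Iio) u G →
        typeIBound (Iio (0 : ℝ) ×ˢ univ) u p G ≤ I →
        HasTypeITimeDecay C u →
        ContinuousOn (uncurry u) (Iio (0 : ℝ) ×ˢ univ) →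
        IsBackwardSingularPoint u 0 →
        ENNReal.ofReal e ≤ ∫⁻ z in parabolicCylinder (1 / 2 : ℝ) ((-(1 / 4) : ℝ), (0 : E³)),
          ENNReal.ofReal (frobeniusNormSq (G z.1 z.2))) →
      ∀ (u : ℝ → E³ → E³) (p : ℝ → E³ → ℝ) (G : ℝ → E³ → E³ →L[ℝ] E³),
        IsSuitableWeakSolutionOn (slab E³ (Iio 0) isOpen_Iio) 1 0 u p →
        HasWeakSpatialGradientOn (slab E³ (Iio 0) isOpen_Iio) u G →
        typeIBound (Iio (0 : ℝ) ×ˢ univ) u p G ≤ I →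
        HasTypeITimeDecay C u →
        ContinuousOn (uncurry u) (Iio (0 : ℝ) ×ˢ univ) →
        ∀ b : E³, IsBackwardSingularPoint u ((0 : ℝ), b) →
        ∀ ρ : ℝ, 0 < ρ → ENNReal.ofReal (e * ρ) ≤
          ∫⁻ z in parabolicCylinder (ρ / 2) ((-(ρ ^ 2 / 4) : ℝ), b),
            ENNReal.ofReal (frobeniusNormSq (G z.1 z.2)) := by
  intro C I e he hq u p G hsw hwg hIle hC hcont b hsing ρ hρ
  -- class data and singular origin of the image `ρ u(ρ² t, b + ρ x)`
  obtain ⟨hsw', hwg', hIle', hC', hcont'⟩ := image_classData hsw hwg hIle hC hcont hρ b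
  have hq' := hq _ _ _ hsw' hwg' hIle' hC' hcont' (isBackwardSingularPoint_image_of_centre hsing hρ)
  -- change of variables on the unit band
  have hle : ENNReal.ofReal e ≤ (ENNReal.ofReal ρ)⁻¹ *
      ∫⁻ z in parabolicCylinder (ρ / 2) ((-(ρ ^ 2 / 4) : ℝ), b),
        ENNReal.ofReal (frobeniusNormSq (G z.1 z.2)) :=
    hq'.trans_eq (lintegral_unitBand_image_eq b hρ)
  have hρ0 : ENNReal.ofReal ρ ≠ 0 := (ENNReal.ofReal_pos.2 hρ).ne'
  calc ENNReal.ofReal (e * ρ) = ENNReal.ofReal ρ * ENNReal.ofReal e := by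
        rw [ENNReal.ofReal_mul he, mul_comm]
    _ ≤ ENNReal.ofReal ρ * ((ENNReal.ofReal ρ)⁻¹ *
          ∫⁻ z in parabolicCylinder (ρ / 2) ((-(ρ ^ 2 / 4) : ℝ), b),
            ENNReal.ofReal (frobeniusNormSq (G z.1 z.2))) := mul_le_mul_right hle _
    _ = ∫⁻ z in parabolicCylinder (ρ / 2) ((-(ρ ^ 2 / 4) : ℝ), b),
            ENNReal.ofReal (frobeniusNormSq (G z.1 z.2)) := by
        rw [← mul_assoc, ENNReal.mul_inv_cancel hρ0 ENNReal.ofReal_ne_top, one_mul]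

end Summit.NavierStokesRegularity.NavierStokesRegularity.Theorems.RellichScarApexLocalisation
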